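import Summits.NavierStokesRegularity.NavierStokesRegularity.Theorems.ScenarioCensusRowF1EquilibriumTransfer
import Summits.NavierStokesRegularity.NavierStokesRegularity.Theorems.ScenarioCensusRowF1FrozenTop
import HarnessLib

/-!
# LINE «equilibrium-top» port, part 4/4: §7 rows `Row_F1eqq` / `Row_F1bnq` / `Row_F1eq` / `Row_F1bn`, Liouville rows, floor `DrivenTop`, residual `DriveDefectSlack` (≡ `Row_F1`);
# the rows are EXCLUDED, `drivenTop_holds`, displays, `driveDefectSlack_iff_rowF1`; census KEYS `Row_F1eqq` / `Row_F1bnq` / `Row_F1eq` / `Row_F1bn` + `_excluded`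

Re-homed for the scenario census (typer seat ns-census-typer-1 g8; the cells F1eqq / F1bnq and the o-forms F1eq / F1bn are MEMBERS OF RECORD «DECIDED IN KERNEL IN FILES» of
row F1 since census v1.71 (critic idea-crit-3 PASS; ref ns-census-ref g8 PRE-CHECK ✓; lead-presearch label); this port makes them TREE-decided): VERBATIM PORT of ns-idea-3
LINE 19 «equilibrium-top», `pub/ideators/ns-idea-3/lines/equilibrium-top/line-equilibrium-top.lean` sha16 a530d660993acd54 (1664 l., lean check rc 0, 0 sorry), split
for the 400-line rule into `ScenarioCensusRowF1Equilibrium` (§1–§2) → `…EquilibriumKill` (§3–§5) → `…EquilibriumTransfer` (§6) → `…EquilibriumTop` (§7 + census KEYS).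
Lean text VERBATIM in namespace `…Theorems.ScenarioCensus.EquilibriumTop` (the line's `…Cruxes.ScenarioCensusRowF1.EquilibriumTopLine` re-homed); port edits:
`@[conjecture]` on the residual `DriveDefectSlack` (≡ `ScenarioCensus.Row_F1`, OPEN), one-line docstrings added where missing (gate lint); the lemmas the line shares
VERBATIM with the landed inviscid-top / frozen-top / columnar-top / stretched-top ports — including the §4 weak time-rigidity chain `cp` … `eq_zero_of_frozenVorticity`,
which the frozen-top port carries verbatim (and with it the one use of `Literature.Analysis.FunctionSpaces.WeakTimeDerivativeClassical`) — are taken BY NAME (listed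
below); the line's direct WTDC import is therefore not needed here.  Statements untouched.

No census VALUE is moved here (row F1 stays OPEN-WITH-LINE; the members become TREE-decided by name); NS regularity is NOT proved; `Row_F1` is untouched
(zero movement, `driveDefectSlack_iff_rowF1`); no summit statement is proved by this file. Lemmas that restate already-landed tree declarations are taken BY NAME (gate lint `dedup.landed`): `fderiv_smul_stPull_apply` = `InviscidTop.fderiv_smul_stPull_apply`, `fderiv_smul_stPull` = `InviscidTop.fderiv_smul_stPull`, `fderiv_fderiv_smul_stPull` = `InviscidTop.fderiv_fderiv_smul_stPull`, `fderiv_fderiv_zoom` = `InviscidTop.fderiv_fderiv_zoom`, `tendsto_clm_of_tendsto_apply` = `InviscidTop.tendsto_clm_of_tendsto_apply`, `tendsto_fderiv_fderiv_apply_of_bound` = `InviscidTop.tendsto_fderiv_fderiv_apply_of_bound`, `tendsto_fderiv_fderiv_of_bound` = `InviscidTop.tendsto_fderiv_fderiv_of_bound`, `tendsto_fderiv_fderiv_of_typeI_seq_Ioo` = `InviscidTop.tendsto_fderiv_fderiv_of_typeI_seq_Ioo`, `tendsto_fderiv_fderiv_of_isTypeIAncientMild_seq` = `InviscidTop.tendsto_fderiv_fderiv_of_isTypeIAncientMild_seq`,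 `cp` = `FrozenTop.cp`, `cp_isTest` = `FrozenTop.cp_isTest`, `cp_isDivFree` = `FrozenTop.cp_isDivFree`, `pairing_eq_of_weakEquilibrium` = `FrozenTop.pairing_eq_of_weakEquilibrium`, `slice_sub_const_of_pairing_eq` = `FrozenTop.slice_sub_const_of_pairing_eq`, `eq_zero_of_increments_const` = `FrozenTop.eq_zero_of_increments_const`, `eq_zero_of_weakEquilibrium` = `FrozenTop.eq_zero_of_weakEquilibrium`, `eq_zero_of_frozenVorticity` = `FrozenTop.eq_zero_of_frozenVorticity`, `tendsto_physicalTime` = `ColumnarTop.tendsto_physicalTime`, `eventually_fast` = `ColumnarTop.eventually_fast`, `sqrt_timeLag` = `StretchedTop.sqrt_timeLag`, `forall_of_forall_ne_zero` = `StretchedTop.forall_of_forall_ne_zero`, `radius_eq` = `FrozenTop.radius_eq`, `sing_of_not_bounded` = `InviscidTop.sing_of_not_bounded`, `exists_singularZoom_package₂` = `InviscidTop.exists_singularZoom_package₂`, `clock₂_eq` = `InviscidTop.clock₂_eq`.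
-/

-- the summit and its single problem share the name `NavierStokesRegularity` (D-0017 nested layout)
set_option linter.dupNamespace false

noncomputable section

open MeasureTheory Set Function Filter TopologicalSpace Metric
open scoped Topology NNReal ENNReal InnerProductSpace RealInnerProductSpace Laplacian

namespace Summit.NavierStokesRegularity.NavierStokesRegularity.Theorems.ScenarioCensus.EquilibriumTop

open Literature.Analysis Literature.Analysis.FluidPDE
open Summit.NavierStokesRegularity.NavierStokesRegularity.Theorems

/-! ## §7 Rows, Liouville rows, floor, residual; the rows are EXCLUDED; displays; residual ≡ `Row_F1` -/

/-- **Criterion row F1eqq** (`M`-quantitative form: Type I(`M`) + ε(M)-EQUILIBRIUM TOP ⇒ extension): for every `M`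
ONE `ε > 0` such that the frame of `Row_F1` + `IsTypeIBlowupWith M ν u T` + a subcritical level with
`(T − t)^{3/2} ν^{-1/2} ‖∂ₜu + ∇p‖ ≤ ε` on its top ⇒ `HasSmoothExtensionPast`.  PROVED (`rowF1eqq_holds`). -/
def Row_F1eqq : Prop :=
  ∀ M : ℝ, ∃ ε : ℝ, 0 < ε ∧ ∀ (ν T : ℝ), 0 < ν → 0 < T →
    ∀ (u : ℝ → E3 → E3) (p : ℝ → E3 → ℝ),
    IsClassicalNSSolutionOn (Ico 0 T) ν 0 u p → IsLerayHopfOn T ν 0 (u 0) u →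
    HasRapidSpatialDecay (u 0) → IsTypeIBlowupWith M ν u T →
    (∃ Λ : ℝ → ℝ, IsSubcriticalLevel T Λ ∧ HasDriveDefectAt T Λ ν ε u p) →
    HasSmoothExtensionPast ν 0 u T

/-- **Criterion row F1bnq** (Type I(`M`) + ε(M)-BERNOULLI TOP ⇒ extension).  PROVED (`rowF1bnq_holds`). -/
def Row_F1bnq : Prop :=
  ∀ M : ℝ, ∃ ε : ℝ, 0 < ε ∧ ∀ (ν T : ℝ), 0 < ν → 0 < T →
    ∀ (u : ℝ → E3 → E3) (p : ℝ → E3 → ℝ),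
    IsClassicalNSSolutionOn (Ico 0 T) ν 0 u p → IsLerayHopfOn T ν 0 (u 0) u →
    HasRapidSpatialDecay (u 0) → IsTypeIBlowupWith M ν u T →
    (∃ Λ : ℝ → ℝ, IsSubcriticalLevel T Λ ∧ HasHeadDefectAt T Λ ν ε u p) →
    HasSmoothExtensionPast ν 0 u T

/-- **Criterion row F1eq** (`o`-form, the exact frame of `Row_F1` plus ONE hypothesis: an `o`-EQUILIBRIUM TOP — some
subcritical level on whose top `(T − t)^{3/2} ν^{-1/2} ‖∂ₜu + ∇p‖ → 0`, i.e. the defect holds for EVERY `ε > 0`).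
PROVED (`rowF1eq_holds`). -/
def Row_F1eq : Prop :=
  ∀ (ν T : ℝ), 0 < ν → 0 < T → ∀ (u : ℝ → E3 → E3) (p : ℝ → E3 → ℝ),
    IsClassicalNSSolutionOn (Ico 0 T) ν 0 u p → IsLerayHopfOn T ν 0 (u 0) u →
    HasRapidSpatialDecay (u 0) → IsTypeIBlowup u T →
    (∃ Λ : ℝ → ℝ, IsSubcriticalLevel T Λ ∧ ∀ ε : ℝ, 0 < ε → HasDriveDefectAt T Λ ν ε u p) →
    HasSmoothExtensionPast ν 0 u T

/-- **Criterion row F1bn** (`o`-BERNOULLI TOP: `(T − t)^{3/2} ν^{-1/2} ‖∂ₜu + ∇(p + |u|²/2)‖ → 0` on the top).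
PROVED (`rowF1bn_holds`). -/
def Row_F1bn : Prop :=
  ∀ (ν T : ℝ), 0 < ν → 0 < T → ∀ (u : ℝ → E3 → E3) (p : ℝ → E3 → ℝ),
    IsClassicalNSSolutionOn (Ico 0 T) ν 0 u p → IsLerayHopfOn T ν 0 (u 0) u →
    HasRapidSpatialDecay (u 0) → IsTypeIBlowup u T →
    (∃ Λ : ℝ → ℝ, IsSubcriticalLevel T Λ ∧ ∀ ε : ℝ, 0 < ε → HasHeadDefectAt T Λ ν ε u p) →
    HasSmoothExtensionPast ν 0 u T

/-- **Ancient row (exact, steady slices)**: a `𝒦_C` field each of whose slices is a steady unit-viscosity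
Navier–Stokes flow for some `C¹` pressure is trivial.  PROVED (`liouville_steady_holds`). -/
def Liouville_steady : Prop :=
  ∀ (C : ℝ) (W : ℝ → E3 → E3), IsTypeIAncientMild C W →
    (∀ s < (0 : ℝ), ∃ q : E3 → ℝ, ContDiff ℝ 1 q ∧
      ∀ y : E3, (Δ (W s)) y - convect (W s) (W s) y = gradient q y) →
    ∀ s < (0 : ℝ), ∀ y : E3, W s y = 0

/-- **Ancient row (exact, frozen vorticity)**: a `𝒦_C` field whose vorticity does not depend on time is trivial.
PROVED (`liouville_frozenVorticity_holds`). -/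
def Liouville_frozenVorticity : Prop :=
  ∀ (C : ℝ) (W : ℝ → E3 → E3), IsTypeIAncientMild C W →
    (∀ s < (0 : ℝ), ∀ t < (0 : ℝ), ∀ y : E3, curl (W t) y = curl (W s) y) →
    ∀ s < (0 : ℝ), ∀ y : E3, W s y = 0

/-- **Ancient row (ε-Liouville, almost-equilibrium)**: ∀ M ∃ ε(M) > 0: `(−s)^{3/2} ‖ΔW − (W·∇)W‖ ≤ ε` on the open
past ⇒ `W ≡ 0`.  PROVED (`liouville_eqq_holds`). -/
def Liouville_eqq : Prop :=
  ∀ M : ℝ, ∃ ε : ℝ, 0 < ε ∧ ∀ W : ℝ → E3 → E3, IsTypeIAncientMild M W →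
    (∀ s < (0 : ℝ), ∀ y : E3, (-s) * Real.sqrt (-s) * ‖(Δ (W s)) y - convect (W s) (W s) y‖ ≤ ε) →
    ∀ s < (0 : ℝ), ∀ y : E3, W s y = 0

/-- **Ancient row (ε-Liouville, almost-Lamb-balanced)**.  PROVED (`liouville_bnq_holds`). -/
def Liouville_bnq : Prop :=
  ∀ M : ℝ, ∃ ε : ℝ, 0 < ε ∧ ∀ W : ℝ → E3 → E3, IsTypeIAncientMild M W →
    (∀ s < (0 : ℝ), ∀ y : E3, (-s) * Real.sqrt (-s) * ‖(Δ (W s)) y - cross (curl (W s) y) (W s y)‖ ≤ ε) →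
    ∀ s < (0 : ℝ), ∀ y : E3, W s y = 0

/-- **DRIVEN TOP** (structural floor, maximal frame): for every `M` one `ε(M) > 0` such that a maximal Type-I(`M`)
Clay blow-up has, on the top of EVERY subcritical level, neither of the two dynamic ε-defects: the fast fluid keeps
an Eulerian drive `‖∂ₜu + ∇p‖ ≥ ε √ν (T − t)^{-3/2}` and a Bernoulli drive `‖∂ₜu + ∇(p + |u|²/2)‖ ≥ ε √ν (T − t)^{-3/2}`,
infinitely often as `t ↑ T`.  PROVED (`drivenTop_holds`). -/
def DrivenTop : Prop :=
  ∀ M : ℝ, ∃ ε : ℝ, 0 < ε ∧ ∀ (ν T : ℝ), 0 < ν → 0 < T →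
    ∀ (u : ℝ → E3 → E3) (p : ℝ → E3 → ℝ),
    IsMaximalSmoothSolution ν 0 u p T → IsLerayHopfOn T ν 0 (u 0) u →
    HasRapidSpatialDecay (u 0) → IsTypeIBlowupWith M ν u T →
    ∀ Λ : ℝ → ℝ, IsSubcriticalLevel T Λ →
      ¬ HasDriveDefectAt T Λ ν ε u p ∧ ¬ HasHeadDefectAt T Λ ν ε u p

/-- **Residual** (maximal frame): for every `M` and every `ε > 0`, every maximal Type-I(`M`) Clay blow-up has an
ε-equilibrium top at some subcritical level.  DECLARED ≡ row F1 (`driveDefectSlack_iff_rowF1`); no movement on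
`Row_F1` is claimed. -/
@[conjecture] def DriveDefectSlack : Prop :=
  ∀ (M ε : ℝ), 0 < ε → ∀ (ν T : ℝ), 0 < ν → 0 < T →
    ∀ (u : ℝ → E3 → E3) (p : ℝ → E3 → ℝ),
    IsMaximalSmoothSolution ν 0 u p T → IsLerayHopfOn T ν 0 (u 0) u →
    HasRapidSpatialDecay (u 0) → IsTypeIBlowupWith M ν u T →
    ∃ Λ : ℝ → ℝ, IsSubcriticalLevel T Λ ∧ HasDriveDefectAt T Λ ν ε u p

/-- **The split**: criterion + residual ⇒ row F1 (by cases on extendability; `M = C/√ν`). -/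
theorem rowF1_of (hD : Row_F1eqq) (hR : DriveDefectSlack) : ScenarioCensus.Row_F1 := by
  unfold ScenarioCensus.Row_F1
  intro ν T hν hT u p hsol hLH hdec hTI
  obtain ⟨M, hM⟩ := exists_isTypeIBlowupWith hν hTI
  obtain ⟨ε, hε, hrow⟩ := hD M
  by_contra hext
  exact hext (hrow ν T hν hT u p hsol hLH hdec hM (hR M ε hε ν T hν hT u p ⟨hsol, hext⟩ hLH hdec hM))

/-- The residual is a consequence of the row (vacuously: under `Row_F1` no maximal solution is Type I). -/
theorem driveDefectSlack_of_rowF1 (h : ScenarioCensus.Row_F1) : DriveDefectSlack :=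
  fun _ _ _ ν T hν hT u p hmax hLH hdec hTI =>
    (hmax.2 (h ν T hν hT u p hmax.1 hLH hdec hTI.isTypeIBlowup)).elim

/-- The `o`-rows follow from the `M`-quantitative rows. -/
theorem rowF1eq_of_rowF1eqq (h : Row_F1eqq) : Row_F1eq := by
  intro ν T hν hT u p hsol hLH hdec hTI ⟨Λ, hΛ, hall⟩
  obtain ⟨M, hM⟩ := exists_isTypeIBlowupWith hν hTI
  obtain ⟨ε, hε, hrow⟩ := h M
  exact hrow ν T hν hT u p hsol hLH hdec hM ⟨Λ, hΛ, hall ε hε⟩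

/-- The `o`-form F1bn follows from the `M`-quantitative form F1bnq. -/
theorem rowF1bn_of_rowF1bnq (h : Row_F1bnq) : Row_F1bn := by
  intro ν T hν hT u p hsol hLH hdec hTI ⟨Λ, hΛ, hall⟩
  obtain ⟨M, hM⟩ := exists_isTypeIBlowupWith hν hTI
  obtain ⟨ε, hε, hrow⟩ := h M
  exact hrow ν T hν hT u p hsol hLH hdec hM ⟨Λ, hΛ, hall ε hε⟩

/-- The Liouville rows hold (in kernel). -/
theorem liouville_steady_holds : Liouville_steady := fun _ _ hW h => eq_zero_of_steadySlices hW h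

/-- The exact Liouville row (frozen vorticity) holds. -/
theorem liouville_frozenVorticity_holds : Liouville_frozenVorticity :=
  fun _ _ hW h => FrozenTop.eq_zero_of_frozenVorticity hW h

/-- The ε-Liouville row (almost-equilibrium) holds. -/
theorem liouville_eqq_holds : Liouville_eqq := exists_eps_liouville_equilibrium

/-- The ε-Liouville row (almost-Bernoulli) holds. -/
theorem liouville_bnq_holds : Liouville_bnq := exists_eps_liouville_lamb

-- `sing_of_not_bounded`: the line restates the tree's `InviscidTop.sing_of_not_bounded`; taken BY NAME (gate lint dedup.landed).

/-- **Criterion row F1eqq is EXCLUDED** (in kernel): Type I(`M`) + ε(M)-equilibrium top ⇒ extension. -/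
theorem rowF1eqq_holds : Row_F1eqq := by
  intro M
  obtain ⟨ε, hε, hLiou⟩ := exists_eps_liouville_equilibrium M
  refine ⟨ε, hε, fun ν T hν hT u p hsol hLH hdec hTI htop => ?_⟩
  obtain ⟨Λ, hΛ, hdef⟩ := htop
  have hH : HasJointDefectAt T Λ ν ε (fun v L H => ‖eqOf v L H‖) u :=
    (hasEquilibriumDefectAt_iff_joint hν).1 ((hasDriveDefectAt_iff hT hsol).1 hdef)
  apply hasSmoothExtensionPast_of_forall_exists_parabolicCylinder hν hT hsol hLH hdec
  intro x₀
  by_contra hno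
  obtain ⟨α, β, R, c, W, hα, hβ, hR, hαR, hαν, hcpos, hclim, hW, hpt, hgrad, hhess, t, ht, y, hne⟩ :=
    InviscidTop.exists_singularZoom_package₂ hν hT hsol hLH hdec hTI x₀ (InviscidTop.sing_of_not_bounded hno)
  have hall := joint_transfer_everywhere hW hν hα hβ hαR hαν hcpos hclim hpt hgrad hhess
    (Rd := fun v L H => ‖eqOf v L H‖) continuous_eqOf.norm
    (fun a ha v L H => by show ‖eqOf (a • v) (a ^ 2 • L) (a ^ 3 • H)‖ = a ^ 3 * ‖eqOf v L H‖
                          rw [eqOf_smul, norm_smul, Real.norm_eq_abs, abs_of_pos (pow_pos ha 3)])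
    (by show ‖eqOf 0 0 0‖ = 0; simp [eqOf, lapOf]) hε.le hΛ hH
  exact hne (hLiou W hW (fun s hs y' => by rw [laplacian_sub_convect_eq_eqOf]; exact hall s hs y') t ht y)

/-- **Criterion row F1bnq is EXCLUDED** (in kernel): Type I(`M`) + ε(M)-Bernoulli top ⇒ extension. -/
theorem rowF1bnq_holds : Row_F1bnq := by
  intro M
  obtain ⟨ε, hε, hLiou⟩ := exists_eps_liouville_lamb M
  refine ⟨ε, hε, fun ν T hν hT u p hsol hLH hdec hTI htop => ?_⟩
  obtain ⟨Λ, hΛ, hdef⟩ := htop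
  have hH : HasJointDefectAt T Λ ν ε (fun v L H => ‖lambOf v L H‖) u :=
    (hasLambDefectAt_iff_joint hν).1 ((hasHeadDefectAt_iff hT hsol).1 hdef)
  apply hasSmoothExtensionPast_of_forall_exists_parabolicCylinder hν hT hsol hLH hdec
  intro x₀
  by_contra hno
  obtain ⟨α, β, R, c, W, hα, hβ, hR, hαR, hαν, hcpos, hclim, hW, hpt, hgrad, hhess, t, ht, y, hne⟩ :=
    InviscidTop.exists_singularZoom_package₂ hν hT hsol hLH hdec hTI x₀ (InviscidTop.sing_of_not_bounded hno)
  have hall := joint_transfer_everywhere hW hν hα hβ hαR hαν hcpos hclim hpt hgrad hhess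
    (Rd := fun v L H => ‖lambOf v L H‖) continuous_lambOf.norm
    (fun a ha v L H => by show ‖lambOf (a • v) (a ^ 2 • L) (a ^ 3 • H)‖ = a ^ 3 * ‖lambOf v L H‖
                          rw [lambOf_smul, norm_smul, Real.norm_eq_abs, abs_of_pos (pow_pos ha 3)])
    (by show ‖lambOf 0 0 0‖ = 0; simp [lambOf, lapOf, cross]) hε.le hΛ hH
  exact hne (hLiou W hW (fun s hs y' => by rw [laplacian_sub_lamb_eq_lambOf]; exact hall s hs y') t ht y)

/-- The `o`-rows hold (in kernel). -/
theorem rowF1eq_holds : Row_F1eq := rowF1eq_of_rowF1eqq rowF1eqq_holds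

/-- **Row F1bn holds.** -/
theorem rowF1bn_holds : Row_F1bn := rowF1bn_of_rowF1bnq rowF1bnq_holds

/-- **The floor DRIVEN TOP holds** (one `ε(M)` for both defects: the minimum). -/
theorem drivenTop_holds : DrivenTop := by
  intro M
  obtain ⟨ε₁, hε₁, h₁⟩ := rowF1eqq_holds M
  obtain ⟨ε₂, hε₂, h₂⟩ := rowF1bnq_holds M
  refine ⟨min ε₁ ε₂, lt_min hε₁ hε₂, fun ν T hν hT u p hmax hLH hdec hTI Λ hΛ => ⟨fun h => ?_, fun h => ?_⟩⟩
  · exact hmax.2 (h₁ ν T hν hT u p hmax.1 hLH hdec hTI ⟨Λ, hΛ, h.mono (min_le_left _ _)⟩)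
  · exact hmax.2 (h₂ ν T hν hT u p hmax.1 hLH hdec hTI ⟨Λ, hΛ, h.mono (min_le_right _ _)⟩)

/-- **DRIVEN TOP, unfolded** (display, constant levels): ∀ M ∃ ε(M) > 0: in the maximal Type-I(`M`) Clay frame, for
EVERY speed `Λ` and every `t₁ < T` some `t ∈ (t₁, T)` has a `Λ`-fast point with
`(T − t)^{3/2} ν^{-1/2} ‖∂ₜu(t, x) + ∇p(t, x)‖ > ε` — the Eulerian drive on the fast fluid is `> ε √ν (T − t)^{-3/2}`, an
`ε/M`-fraction of the inertial scale, arbitrarily close to `T`: the fast fluid of a Type-I blow-up is never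
asymptotically in Eulerian equilibrium. -/
theorem drivenTop_unfolded : ∀ M : ℝ, ∃ ε : ℝ, 0 < ε ∧ ∀ (ν T : ℝ), 0 < ν → 0 < T →
    ∀ (u : ℝ → E3 → E3) (p : ℝ → E3 → ℝ),
    IsMaximalSmoothSolution ν 0 u p T → IsLerayHopfOn T ν 0 (u 0) u →
    HasRapidSpatialDecay (u 0) → IsTypeIBlowupWith M ν u T →
    ∀ Λ : ℝ, ∀ t₁ : ℝ, t₁ < T →
      ∃ t ∈ Ioo t₁ T, ∃ x : E3, Λ < ‖u t x‖ ∧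
        ε < (T - t) * Real.sqrt (T - t) / Real.sqrt ν *
          ‖timeDerivWithin (Ico 0 T) u t x + gradient (p t) x‖ := by
  intro M
  obtain ⟨ε, hε, hfl⟩ := drivenTop_holds M
  refine ⟨ε, hε, fun ν T hν hT u p hmax hLH hdec hTI Λ t₁ ht₁ => ?_⟩
  by_contra hno
  push Not at hno
  refine (hfl ν T hν hT u p hmax hLH hdec hTI (fun _ => Λ) (isSubcriticalLevel_const T Λ)).1 ?_
  refine eventually_of_mem (Ioo_mem_nhdsLT ht₁) fun t ht x hx => ?_
  have e : clock₂ ν T t / ν = (T - t) * Real.sqrt (T - t) / Real.sqrt ν := by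
    rw [clock₂]
    have hs : Real.sqrt ν ≠ 0 := (Real.sqrt_pos.2 hν).ne'
    rw [div_eq_div_iff hν.ne' hs]
    calc Real.sqrt ν * ((T - t) * Real.sqrt (T - t)) * Real.sqrt ν
        = (Real.sqrt ν * Real.sqrt ν) * ((T - t) * Real.sqrt (T - t)) := by ring
      _ = ν * ((T - t) * Real.sqrt (T - t)) := by rw [Real.mul_self_sqrt hν.le]
      _ = (T - t) * Real.sqrt (T - t) * ν := by ring
  rw [e]
  exact hno t ht x hx

/-- **BERNOULLI DRIVE ON THE TOP, unfolded** (display). -/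
theorem bernoulliTop_unfolded : ∀ M : ℝ, ∃ ε : ℝ, 0 < ε ∧ ∀ (ν T : ℝ), 0 < ν → 0 < T →
    ∀ (u : ℝ → E3 → E3) (p : ℝ → E3 → ℝ),
    IsMaximalSmoothSolution ν 0 u p T → IsLerayHopfOn T ν 0 (u 0) u →
    HasRapidSpatialDecay (u 0) → IsTypeIBlowupWith M ν u T →
    ∀ Λ : ℝ, ∀ t₁ : ℝ, t₁ < T →
      ∃ t ∈ Ioo t₁ T, ∃ x : E3, Λ < ‖u t x‖ ∧
        ε < (T - t) * Real.sqrt (T - t) / Real.sqrt ν *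
          ‖timeDerivWithin (Ico 0 T) u t x + gradient (p t) x + gradient (fun y => ‖u t y‖ ^ 2 / 2) x‖ := by
  intro M
  obtain ⟨ε, hε, hfl⟩ := drivenTop_holds M
  refine ⟨ε, hε, fun ν T hν hT u p hmax hLH hdec hTI Λ t₁ ht₁ => ?_⟩
  by_contra hno
  push Not at hno
  refine (hfl ν T hν hT u p hmax hLH hdec hTI (fun _ => Λ) (isSubcriticalLevel_const T Λ)).2 ?_
  refine eventually_of_mem (Ioo_mem_nhdsLT ht₁) fun t ht x hx => ?_
  have e : clock₂ ν T t / ν = (T - t) * Real.sqrt (T - t) / Real.sqrt ν := by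
    rw [clock₂]
    have hs : Real.sqrt ν ≠ 0 := (Real.sqrt_pos.2 hν).ne'
    rw [div_eq_div_iff hν.ne' hs]
    calc Real.sqrt ν * ((T - t) * Real.sqrt (T - t)) * Real.sqrt ν
        = (Real.sqrt ν * Real.sqrt ν) * ((T - t) * Real.sqrt (T - t)) := by ring
      _ = ν * ((T - t) * Real.sqrt (T - t)) := by rw [Real.mul_self_sqrt hν.le]
      _ = (T - t) * Real.sqrt (T - t) * ν := by ring
  rw [e]
  exact hno t ht x hx

/-- **STEADY TYPE-I ANCIENT SOLUTIONS ARE TRIVIAL, weak form** (display of the kill): `W ∈ 𝒦_C` with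
`ΔW(s) − (W(s)·∇)W(s) ⊥` all curl-type test fields on every slice ⇒ `W ≡ 0`. -/
theorem steady_ancient_trivial {C : ℝ} {W : ℝ → E3 → E3} (hW : IsTypeIAncientMild C W)
    (hbal : ∀ s < (0 : ℝ), ∀ g : E3 → ℝ, FunctionSpaces.IsTestFunctionOn (⊤ : Opens E3) g → ∀ a c : E3,
      ∫ x, ⟪(Δ (W s)) x - convect (W s) (W s) x, fderiv ℝ g x a • c - fderiv ℝ g x c • a⟫ = 0) :
    ∀ s < (0 : ℝ), ∀ y : E3, W s y = 0 :=
  FrozenTop.eq_zero_of_weakEquilibrium hW hbal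

/-- The residual is EXACTLY row F1 (declared; no movement on `Row_F1` is claimed). -/
theorem driveDefectSlack_iff_rowF1 : DriveDefectSlack ↔ ScenarioCensus.Row_F1 :=
  ⟨rowF1_of rowF1eqq_holds, driveDefectSlack_of_rowF1⟩

/-- Deciding direction used by the split. -/
theorem rowF1_of_driveDefectSlack : DriveDefectSlack → ScenarioCensus.Row_F1 :=
  rowF1_of rowF1eqq_holds

end Summit.NavierStokesRegularity.NavierStokesRegularity.Theorems.ScenarioCensus.EquilibriumTop

namespace Summit.NavierStokesRegularity.NavierStokesRegularity.Theorems.ScenarioCensus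

/-! ## Census KEYS (ns `…Theorems.ScenarioCensus`): the DYNAMIC-TOP family of row F1 — TREE-decided members F1eqq / F1bnq / F1eq / F1bn -/

/-- **Cell F1eqq** (row F1 frame VERBATIM + Type I(`M`) + ε(M)-equilibrium top `(T−t)^{3/2} ν^{-1/2}‖∂ₜu + ∇p‖ ≤ ε(M)` on the top of one subcritical level ⇒ smooth extension past `T`): `:= EquilibriumTop.Row_F1eqq`. DECIDED. -/
def Row_F1eqq : Prop := EquilibriumTop.Row_F1eqq
/-- F1eqq is EXCLUDED (decided in the tree): `EquilibriumTop.rowF1eqq_holds`. -/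
theorem row_F1eqq_excluded : Row_F1eqq := EquilibriumTop.rowF1eqq_holds

/-- **Cell F1bnq** (ε(M)-Bernoulli top): `:= EquilibriumTop.Row_F1bnq`. DECIDED. -/
def Row_F1bnq : Prop := EquilibriumTop.Row_F1bnq
/-- F1bnq is EXCLUDED (decided in the tree): `EquilibriumTop.rowF1bnq_holds`. -/
theorem row_F1bnq_excluded : Row_F1bnq := EquilibriumTop.rowF1bnq_holds

/-- **Cell F1eq** (o-form of F1eqq): `:= EquilibriumTop.Row_F1eq`. DECIDED. -/
def Row_F1eq : Prop := EquilibriumTop.Row_F1eq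
/-- F1eq is EXCLUDED (decided in the tree): `EquilibriumTop.rowF1eq_holds`. -/
theorem row_F1eq_excluded : Row_F1eq := EquilibriumTop.rowF1eq_holds

/-- **Cell F1bn** (o-form of F1bnq): `:= EquilibriumTop.Row_F1bn`. DECIDED. -/
def Row_F1bn : Prop := EquilibriumTop.Row_F1bn
/-- F1bn is EXCLUDED (decided in the tree): `EquilibriumTop.rowF1bn_holds`. -/
theorem row_F1bn_excluded : Row_F1bn := EquilibriumTop.rowF1bn_holds

/-- **Floor DRIVEN TOP** at the level of the census keys: `EquilibriumTop.drivenTop_holds`. -/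
theorem row_F1_drivenTop : EquilibriumTop.DrivenTop := EquilibriumTop.drivenTop_holds

end Summit.NavierStokesRegularity.NavierStokesRegularity.Theorems.ScenarioCensus

end
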